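import Mathlib.Algebra.BigOperators.GroupWithZero.Finset
import Mathlib.Data.Fintype.Fin
import Literature.Computability.AlgebraicComplexity.Yab15BRank
import Literature.Computability.AlgebraicComplexity.ABV17SingularLocusBound
import Literature.Analysis.Matrix.DetAddDiagonalMinors
import HarnessLib

/-!
# Yabe 2015, §5: the low-degree parts of `det(A + Λ_n^r)` and the case `r = n - 2k` of Thm. 1.5

Topic `Literature/Computability/AlgebraicComplexity`; sibling proofs file of `Yab15BRank.lean`
(A. Yabe, *Bi-polynomial rank and determinantal complexity*, arXiv:1504.00151, typed by val-lit
t17). Supporting theorems for the proof of **Theorem 1.5** (p0012: "If `r < n - 2k` … then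
`p_{A,2k,r} = 0`"; Lemma 5.3 (ii): "`p_{A,2k,n-2k} = det(A_{2k})`, where `A_{2k}` is the leading
principal submatrix of `A` of size `2k`"), for an `n × n` matrix `A` of homogeneous linear forms and
`Λ_n^r = diag(0,…,0,1,…,1)` (`lambdaDiag`, `r` ones):

* `Yabe.homogeneousComponent_det_add_lambdaDiag_of_lt` — `(det(A + Λ_n^r))^{(d)} = 0` for
  `d < n - r`;
* `Yabe.homogeneousComponent_det_add_lambdaDiag_eq_det_block` — `(det(A + Λ_n^r))^{(n-r)}` is the
  determinant of the leading `(n-r) × (n-r)` block of `A`;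
  both from the principal-minor expansion `det(A + diag d) = Σ_S (∏_{i∉S} d_i) det A_S`
  (`Literature.Analysis.Matrix.det_add_diagonal_eq_sum_minors`): only `S ⊇ {i < n-r}` survive and
  `det A_S` is a form of degree `|S|` (the display `det(A + Λ^r_n) = Σ_{U ⊇ …} det A_U` in the proof
  of Lemma 5.4, p0013);
* `Yabe.bRank_homogeneousComponent_det_add_lambdaDiag_le` — **Lemma 5.3 (i)** conditional on
  Prop. 5.2 (`(h : yabe2015_prop_5_2)`): `brank(p_{A,2k,r}) ≤ 2^{n-r-1}(n + 2(k-1)D^{k-1})` for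
  `r ∈ [n-2k, n-1]`, by induction on `n - r` via the one-entry linearity
  `Yabe.det_updateRow_add_single`;
* `Yabe.yabe2015_thm_1_5_of` — **Theorem 1.5 from Prop. 5.2 and Lemma 5.1** (the printed proof of
  Thm. 1.5, p0012, with Lemma 5.3 (ii) replaced as below);
* `Yabe.bRank_det_le_of_linear` — for a `2k × 2k` matrix `B` of linear forms,
  `brank_k(det B) ≤ 2k · s_{k-1}` (`≤ 2k · D^{k-1}`), by Laplace expansion along the first column and
  the monomial splitting of Lemma 5.6. This REPLACES Lemma 5.3 (ii) (`≤ binom(2k, k)` via a `k`-column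
  Laplace expansion, not available in Mathlib) in the proof of Thm. 1.5: for `n ≥ 2k` one still has
  `2k · D^{k-1} ≤ 2^{2k-2}(n + 2(k-1)D^{k-1})`.

Honest framing: bookkeeping of a published argument; nothing here bears on `VP ≠ VNP`.

## References

* [Yabe2015] A. Yabe, *Bi-polynomial rank and determinantal complexity*, arXiv:1504.00151 (2015),
  §5 (pp. 11–13: Lemma 5.3, proof of Thm. 1.5, Lemma 5.4) and Lemma 5.6 (p. 14).
-/

noncomputable section

open MvPolynomial Matrix Finset

namespace Literature.Computability.AlgebraicComplexity

universe u v

namespace Yabe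

variable {K : Type u} [Field K] {σ : Type v}

/-- **The principal-minor expansion of `det(A + Λ_n^r)` in degree `d`** (Yabe 2015, proof of
Lemma 5.4, display (eq_lem2_1): "`det(A(x) + Λ^r_n) = Σ_U det(A_U(x))`" over the `U` containing the
zero positions of `Λ`): the degree-`d` part is the sum of the principal minors `det A_S` over the
`S ⊇ {i : i < n - r}` with `|S| = d`. [cite: Yabe2015, Lemma 5.4 (proof)] -/
theorem homogeneousComponent_det_add_lambdaDiag_eq_sum_minors {n r : ℕ}
    (A : Matrix (Fin n) (Fin n) (MvPolynomial σ K)) (hA : ∀ i j, (A i j).IsHomogeneous 1) (d : ℕ) :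
    homogeneousComponent d (A + (lambdaDiag K n r).map C).det =
      ∑ S : Finset (Fin n),
        if (∀ i ∈ Sᶜ, n - r ≤ (i : ℕ)) ∧ S.card = d then
          (A.submatrix ((↑) : S → Fin n) ((↑) : S → Fin n)).det else 0 := by
  classical
  have hdiag : (lambdaDiag K n r).map (C : K →+* MvPolynomial σ K) =
      diagonal fun i : Fin n => if n - r ≤ (i : ℕ) then (1 : MvPolynomial σ K) else 0 := by
    rw [lambdaDiag, Matrix.diagonal_map (map_zero C)]
    congr 1
    funext i
    by_cases h : n - r ≤ (i : ℕ) <;> simp [h]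
  rw [hdiag, Literature.Analysis.Matrix.det_add_diagonal_eq_sum_minors, map_sum]
  refine Finset.sum_congr rfl fun S _ => ?_
  rw [Finset.prod_boole]
  have hhom := AlperBogartVelasco.isHomogeneous_det_of_linear (A.submatrix ((↑) : S → Fin n) ((↑) : S → Fin n))
    (fun i j => hA _ _)
  rw [Fintype.card_coe] at hhom
  by_cases hS : ∀ i ∈ Sᶜ, n - r ≤ (i : ℕ)
  · rw [if_pos hS, one_mul, homogeneousComponent_of_mem hhom]
    by_cases hd : S.card = d
    · rw [if_pos hd.symm, if_pos ⟨hS, hd⟩]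
    · rw [if_neg (fun h => hd h.symm), if_neg (fun h => hd h.2)]
  · rw [if_neg hS, zero_mul, map_zero, if_neg (fun h => hS h.1)]

/-- The zero positions `{i : i < n - r}` of `Λ_n^r` number `n - r`. [cite: Yabe2015, §5] -/
private theorem card_filter_lt_sub (n r : ℕ) :
    (Finset.univ.filter fun i : Fin n => (i : ℕ) < n - r).card = n - r := by
  rw [Fin.card_filter_val_lt]
  exact Nat.min_eq_right (Nat.sub_le n r)

/-- A set `S` containing all zero positions of `Λ_n^r` has at least `n - r` elements, with
equality only for the set of zero positions itself. [cite: Yabe2015, §5] -/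
private theorem le_card_of_compl {n r : ℕ} {S : Finset (Fin n)} (hS : ∀ i ∈ Sᶜ, n - r ≤ (i : ℕ)) :
    (Finset.univ.filter fun i : Fin n => (i : ℕ) < n - r) ⊆ S := by
  intro i hi
  rw [Finset.mem_filter] at hi
  by_contra h
  have := hS i (Finset.mem_compl.2 h)
  omega

/-- **"If `r < n - 2k` then `p_{A,2k,r} = 0`"** (Yabe 2015, proof of Thm. 1.5, p0012): the
degree-`d` part of `det(A + Λ_n^r)` vanishes for `d < n - r`. [cite: Yabe2015, Theorem 1.5 (proof)] -/
theorem homogeneousComponent_det_add_lambdaDiag_of_lt {n r d : ℕ}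
    (A : Matrix (Fin n) (Fin n) (MvPolynomial σ K)) (hA : ∀ i j, (A i j).IsHomogeneous 1)
    (hd : d < n - r) : homogeneousComponent d (A + (lambdaDiag K n r).map C).det = 0 := by
  classical
  rw [homogeneousComponent_det_add_lambdaDiag_eq_sum_minors A hA d]
  refine Finset.sum_eq_zero fun S _ => if_neg ?_
  rintro ⟨hS, hcard⟩
  have h := Finset.card_le_card (le_card_of_compl hS)
  rw [card_filter_lt_sub, hcard] at h
  omega

/-- **Lemma 5.3 (ii), first sentence: `p_{A,2k,n-2k} = det(A_{2k})`** (Yabe 2015, p0012) — in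
general, the degree-`(n-r)` part of `det(A + Λ_n^r)` is the determinant of the leading
`(n-r) × (n-r)` block of `A`. [cite: Yabe2015, Lemma 5.3] -/
theorem homogeneousComponent_det_add_lambdaDiag_eq_det_block {n r : ℕ}
    (A : Matrix (Fin n) (Fin n) (MvPolynomial σ K)) (hA : ∀ i j, (A i j).IsHomogeneous 1) :
    homogeneousComponent (n - r) (A + (lambdaDiag K n r).map C).det =
      (A.submatrix (Fin.castLE (Nat.sub_le n r)) (Fin.castLE (Nat.sub_le n r))).det := by
  classical
  rw [homogeneousComponent_det_add_lambdaDiag_eq_sum_minors A hA (n - r)]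
  have hZcard : (Finset.univ.filter fun i : Fin n => (i : ℕ) < n - r).card = n - r :=
    card_filter_lt_sub n r
  have hZcond : (∀ i ∈ (Finset.univ.filter fun i : Fin n => (i : ℕ) < n - r)ᶜ, n - r ≤ (i : ℕ)) ∧
      (Finset.univ.filter fun i : Fin n => (i : ℕ) < n - r).card = n - r := by
    refine ⟨fun i hi => ?_, hZcard⟩
    rw [Finset.mem_compl, Finset.mem_filter] at hi
    have : ¬ ((i : ℕ) < n - r) := fun h => hi ⟨Finset.mem_univ _, h⟩
    omega
  rw [Finset.sum_eq_single (Finset.univ.filter fun i : Fin n => (i : ℕ) < n - r)]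
  · rw [if_pos hZcond]
    -- reindex the principal minor on `Z = {i < n - r}` along `Fin (n - r) ≃ Z`
    let e : Fin (n - r) ≃ (Finset.univ.filter fun i : Fin n => (i : ℕ) < n - r) :=
      { toFun := fun j => ⟨Fin.castLE (Nat.sub_le n r) j,
          Finset.mem_filter.2 ⟨Finset.mem_univ _, j.2⟩⟩
        invFun := fun i => ⟨(i : Fin n), (Finset.mem_filter.1 i.2).2⟩
        left_inv := fun j => by ext; rfl
        right_inv := fun i => by ext; rfl }
    rw [← Matrix.det_submatrix_equiv_self e]
    rfl
  · intro S _ hSZ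
    refine if_neg ?_
    rintro ⟨hS, hcard⟩
    exact hSZ (Finset.eq_of_subset_of_card_le (le_card_of_compl hS) (by rw [hZcard, hcard])).symm
  · intro h; exact (h (Finset.mem_univ _)).elim

/-! ### `brank(det B) ≤ 2k · s_{k-1}` for a `2k × 2k` matrix of linear forms -/

/-- Every exponent vector of degree `≥ j` dominates one of degree exactly `j`. [folklore] -/
private theorem exists_le_degree_eq'' (m : σ →₀ ℕ) :
    ∀ j : ℕ, j ≤ m.degree → ∃ I : σ →₀ ℕ, I ≤ m ∧ I.degree = j
  | 0, _ => ⟨0, bot_le, by simp⟩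
  | j + 1, hj => by
      obtain ⟨I, hIm, hIj⟩ := exists_le_degree_eq'' m j (Nat.le_of_succ_le hj)
      have hne : I ≠ m := by rintro rfl; omega
      obtain ⟨s, hs⟩ : ∃ s, I s < m s := by
        by_contra h
        simp only [not_exists, not_lt] at h
        exact hne (le_antisymm hIm (Finsupp.le_def.2 h))
      refine ⟨I + Finsupp.single s 1, Finsupp.le_def.2 fun t => ?_, by simp [hIj]⟩
      by_cases hts : t = s
      · subst hts; simp; omega
      · have h0 : Finsupp.single s 1 t = 0 := Finsupp.single_eq_of_ne hts
        simp only [Finsupp.add_apply, h0, add_zero]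
        exact Finsupp.le_def.1 hIm t

/-- **Monomial splitting** (Yabe 2015, Lemma 5.6: "Since each term in `p` is divisible by at least
one of `f_i`, we can obtain a decomposition `p = Σ f_i g_i`" with `f_i` the degree-`t` monomials):
a form `g` of degree `u ≥ t` is `Σ_I x^I · g_I` over the degree-`t` monomials `x^I`, with `g_I`
forms of degree `u - t`. [cite: Yabe2015, Lemma 5.6] -/
theorem exists_eq_sum_monomial_mul [Fintype σ] [DecidableEq σ] {t u : ℕ} {g : MvPolynomial σ K}
    (hg : g.IsHomogeneous u) (htu : t ≤ u) :
    ∃ G : DegIdx σ t → MvPolynomial σ K, (∀ I, (G I).IsHomogeneous (u - t)) ∧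
      g = ∑ I : DegIdx σ t, monomial I.1 (1 : K) * G I := by
  classical
  have hdeg : ∀ m ∈ g.support, m.degree = u := fun m hm => by
    by_contra h
    exact (mem_support_iff.1 hm) (hg.coeff_eq_zero h)
  have hex : ∀ m : σ →₀ ℕ, ∃ I : σ →₀ ℕ, m ∈ g.support → I ≤ m ∧ I.degree = t := fun m => by
    by_cases hm : m ∈ g.support
    · obtain ⟨I, hI⟩ := exists_le_degree_eq'' m t (by rw [hdeg m hm]; exact htu)
      exact ⟨I, fun _ => hI⟩
    · exact ⟨0, fun h => (hm h).elim⟩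
  choose half hhalf using hex
  have hmaps : ∀ m ∈ g.support, half m ∈ degMonomials σ t := fun m hm =>
    mem_degMonomials_iff.2 (hhalf m hm).2
  refine ⟨fun I => ∑ m ∈ g.support with half m = I.1, monomial (m - I.1) (coeff m g), fun I => ?_, ?_⟩
  · refine IsHomogeneous.sum _ _ _ fun m hm => ?_
    obtain ⟨hm, hI⟩ := Finset.mem_filter.1 hm
    refine isHomogeneous_monomial _ ?_
    have h := congrArg Finsupp.degree (add_tsub_cancel_of_le (hhalf m hm).1)
    rw [map_add, (hhalf m hm).2, hdeg m hm] at h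
    rw [← hI]
    omega
  · have h1 : ∀ I : DegIdx σ t, monomial I.1 (1 : K) *
        (∑ m ∈ g.support with half m = I.1, monomial (m - I.1) (coeff m g)) =
        ∑ m ∈ g.support with half m = I.1, monomial m (coeff m g) := fun I => by
      rw [Finset.mul_sum]
      refine Finset.sum_congr rfl fun m hm => ?_
      obtain ⟨hm, hI⟩ := Finset.mem_filter.1 hm
      rw [monomial_mul, one_mul, ← hI, add_tsub_cancel_of_le (hhalf m hm).1]
    calc g = ∑ m ∈ g.support, monomial m (coeff m g) := g.as_sum
      _ = ∑ I ∈ degMonomials σ t, ∑ m ∈ g.support with half m = I, monomial m (coeff m g) :=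
          (Finset.sum_fiberwise_of_maps_to hmaps _).symm
      _ = ∑ I : DegIdx σ t, ∑ m ∈ g.support with half m = I.1, monomial m (coeff m g) :=
          (Finset.sum_coe_sort (degMonomials σ t)
            (fun I => ∑ m ∈ g.support with half m = I, monomial m (coeff m g))).symm
      _ = _ := Finset.sum_congr rfl fun I _ => (h1 I).symm

/-- **The case `r = n - 2k` of Thm. 1.5 without the `k`-column Laplace expansion** (replacing Yabe's
Lemma 5.3 (ii), p0012: "`brank(p_{A,2k,n-2k}) ≤ binom(2k,k)`"): for a `2k × 2k` matrix `B` of linear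
forms (`k ≥ 1`), Laplace expansion along the first column writes `det B = Σ_i (± B_{i1}) · det B^{(i1)}`,
`2k` products of a linear form with a form of degree `2k - 1`; splitting the latter along the
degree-`(k-1)` monomials (Lemma 5.6) gives `brank_k(det B) ≤ 2k · s_{k-1}`.
[cite: Yabe2015, Lemma 5.3] -/
theorem bRank_det_le_of_linear [Fintype σ] [DecidableEq σ] {ι : Type*} [Fintype ι] [DecidableEq ι]
    {k : ℕ} (hk : 1 ≤ k) (hι : Fintype.card ι = 2 * k) (B : Matrix ι ι (MvPolynomial σ K))
    (hB : ∀ i j, (B i j).IsHomogeneous 1) :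
    bRank k B.det ≤ 2 * k * (degMonomials σ (k - 1)).card := by
  classical
  -- reindex along `ι ≃ Fin ((2k - 1) + 1)`
  have hι' : Fintype.card ι = (2 * k - 1) + 1 := by omega
  obtain ⟨e⟩ : Nonempty (ι ≃ Fin (2 * k - 1 + 1)) := ⟨Fintype.equivFinOfCardEq hι'⟩
  set B' : Matrix (Fin (2 * k - 1 + 1)) (Fin (2 * k - 1 + 1)) (MvPolynomial σ K) :=
    B.submatrix e.symm e.symm with hB'
  have hB'1 : ∀ i j, (B' i j).IsHomogeneous 1 := fun i j => hB _ _
  have hdet : B.det = B'.det := (Matrix.det_submatrix_equiv_self e.symm B).symm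
  -- Laplace along column `0`: linear factor `(-1)^i B'_{i0}`, cofactor of degree `2k - 1`
  have hlin : ∀ i : Fin (2 * k - 1 + 1),
      ((-1 : MvPolynomial σ K) ^ (i : ℕ) * B' i 0).IsHomogeneous 1 := fun i => by
    rw [show ((-1 : MvPolynomial σ K) ^ (i : ℕ)) = C ((-1 : K) ^ (i : ℕ)) by
      rw [map_pow, map_neg, map_one]]
    simpa using (isHomogeneous_C σ ((-1 : K) ^ (i : ℕ))).mul (hB'1 i 0)
  have hcof : ∀ i : Fin (2 * k - 1 + 1),
      (B'.submatrix i.succAbove Fin.succ).det.IsHomogeneous (2 * k - 1) := fun i => by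
    simpa [Fintype.card_fin] using AlperBogartVelasco.isHomogeneous_det_of_linear (B'.submatrix i.succAbove Fin.succ)
      (fun a b => hB'1 _ _)
  -- split every cofactor along the degree-`(k-1)` monomials
  have hsplit := fun i : Fin (2 * k - 1 + 1) =>
    exists_eq_sum_monomial_mul (t := k - 1) (hcof i) (by omega)
  choose G hG hGsum using hsplit
  have hdec : B.det = ∑ p : Fin (2 * k - 1 + 1) × DegIdx σ (k - 1),
      ((-1 : MvPolynomial σ K) ^ (p.1 : ℕ) * B' p.1 0 * monomial p.2.1 (1 : K)) * G p.1 p.2 := by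
    rw [hdet, Matrix.det_succ_column_zero, Fintype.sum_prod_type]
    refine Finset.sum_congr rfl fun i _ => ?_
    rw [hGsum i, Finset.mul_sum]
    exact Finset.sum_congr rfl fun I _ => by ring
  have h := bRank_le_of_eq_sum (k := k) _ _
    (fun p : Fin (2 * k - 1 + 1) × DegIdx σ (k - 1) => by
      have h := (hlin p.1).mul (isHomogeneous_monomial (R := K) (d := p.2.1) 1
        (mem_degMonomials_iff.1 p.2.2))
      rwa [show 1 + (k - 1) = k by omega] at h)
    (fun p => by
      have h := hG p.1 p.2
      rwa [show 2 * k - 1 - (k - 1) = k by omega] at h)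
    hdec
  rw [Fintype.card_prod, Fintype.card_fin, show 2 * k - 1 + 1 = 2 * k by omega] at h
  simpa using h

/-- Corollary: `brank_k(det B) ≤ 2k · D^{k-1}` (`s_{k-1} ≤ D^{k-1}`, Prop. 2.6). For `n ≥ 2k` this
is `≤ 2^{2k-2}(n + 2(k-1)D^{k-1})`, the bound Thm. 1.5 needs at `r = n - 2k`.
[cite: Yabe2015, Lemma 5.3] -/
theorem bRank_det_le_of_linear' [Fintype σ] [DecidableEq σ] {ι : Type*} [Fintype ι] [DecidableEq ι]
    {k : ℕ} (hk : 1 ≤ k) (hι : Fintype.card ι = 2 * k) (B : Matrix ι ι (MvPolynomial σ K))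
    (hB : ∀ i j, (B i j).IsHomogeneous 1) :
    bRank k B.det ≤ 2 * k * Fintype.card σ ^ (k - 1) :=
  (bRank_det_le_of_linear hk hι B hB).trans
    (Nat.mul_le_mul_left _ (card_degMonomials_le_pow σ (k - 1)))

/-! ### Lemma 5.3 (i) and the reduction of Theorem 1.5 to Proposition 5.2 and Lemma 5.1 -/

/-- `brank(0) = 0`. [cite: Yabe2015, Definition 1.4] -/
private theorem bRank_zero' (k : ℕ) : bRank k (0 : MvPolynomial σ K) = 0 :=
  Nat.eq_zero_of_le_zero (by
    simpa using bRank_le_of_eq_sum (p := (0 : MvPolynomial σ K)) (k := k)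
      (fun _ : Fin 0 => (0 : MvPolynomial σ K)) (fun _ => 0) (fun _ => isHomogeneous_zero _ _ _)
      (fun _ => isHomogeneous_zero _ _ _) (by simp))

/-- `brank(p - q) ≤ brank(p) + brank(q)` for degree-`2k` forms (concatenate optimal
decompositions, negating one side; Yabe 2015, proof of Lemma 5.3 (i):
"`brank(p_{A,2k,n-(i+1)}) ≤ brank(p_{A,2k,n-i}) + brank(p_{A',2k,(n-1)-i})`").
[cite: Yabe2015, Lemma 5.3 (proof)] -/
private theorem bRank_sub_le' [DecidableEq σ] {k : ℕ} {p q : MvPolynomial σ K}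
    (hp : p.IsHomogeneous (2 * k)) (hq : q.IsHomogeneous (2 * k)) :
    bRank k (p - q) ≤ bRank k p + bRank k q := by
  obtain ⟨f, g, hf, hg, hfg⟩ := exists_eq_sum_mul_of_isHomogeneous hp
  obtain ⟨f', g', hf', hg', hfg'⟩ := exists_eq_sum_mul_of_isHomogeneous hq
  have h := bRank_le_of_eq_sum (k := k) (p := p - q) (Sum.elim f fun i => -f' i) (Sum.elim g g')
    (fun i => by
      rcases i with i | i
      · exact hf i
      · exact (hf' i).neg)
    (fun i => by
      rcases i with i | i
      · exact hg i
      · exact hg' i)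
    (by
      rw [Fintype.sum_sum_type]
      simp only [Sum.elim_inl, Sum.elim_inr, neg_mul, Finset.sum_neg_distrib]
      rw [← hfg, ← hfg', sub_eq_add_neg])
  simpa using h

/-- Adding the unit vector `e_i` to row `i` adds the `(i,i)` minor to the determinant
(one-entry multilinearity; Yabe 2015, proof of Lemma 5.3 (i): "Since determinant is a bi-linear
form, we have `det(A + Λ_n^{n-i}) = det(A + Λ_n^{n-(i+1)}) + det(A' + Λ_{n-1}^{(n-1)-i})`").
[cite: Yabe2015, Lemma 5.3 (proof)] -/
theorem det_updateRow_add_single {R : Type*} [CommRing R] {m : ℕ}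
    (M : Matrix (Fin (m + 1)) (Fin (m + 1)) R) (i : Fin (m + 1)) :
    (M.updateRow i (M i + Pi.single i 1)).det = M.det + (M.submatrix i.succAbove i.succAbove).det := by
  rw [Matrix.det_updateRow_add, Matrix.updateRow_eq_self]
  congr 1
  rw [Matrix.det_succ_row _ i, Finset.sum_eq_single i]
  · rw [Matrix.updateRow_self, Pi.single_eq_same, mul_one, Matrix.submatrix_updateRow_succAbove,
      ← two_mul, pow_mul, neg_one_sq, one_pow, one_mul]
  · intro j _ hji
    rw [Matrix.updateRow_self, Pi.single_eq_of_ne hji, mul_zero, zero_mul]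
  · intro h; exact (h (Finset.mem_univ _)).elim

/-- The value of `Fin.succAbove`: skipping `i₀` shifts the indices `≥ i₀` by one. [folklore] -/
private theorem val_succAbove {m : ℕ} (i₀ : Fin (m + 1)) (a : Fin m) :
    ((i₀.succAbove a : Fin (m + 1)) : ℕ) = if (a : ℕ) < i₀ then (a : ℕ) else a + 1 := by
  by_cases h : (a : ℕ) < i₀
  · rw [if_pos h, Fin.succAbove_of_castSucc_lt i₀ a (Fin.lt_def.2 (by simpa using h)),
      Fin.val_castSucc]
  · rw [if_neg h, Fin.succAbove_of_le_castSucc i₀ a (Fin.le_def.2 (by simpa using Nat.le_of_not_lt h)),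
      Fin.val_succ]

/-- Entries of `Λ_n^r`. [cite: Yabe2015, §5] -/
private theorem lambdaDiag_apply (n r : ℕ) (p q : Fin n) :
    lambdaDiag K n r p q = if p = q then (if n - r ≤ (p : ℕ) then 1 else 0) else 0 := by
  rw [lambdaDiag, Matrix.diagonal_apply]

/-- `Λ_{m+1}^{r+1}` is `Λ_{m+1}^r` plus a `1` in position `i₀ = m - r` (the last zero of `Λ^r`).
[cite: Yabe2015, Lemma 5.3 (proof)] -/
private theorem add_lambdaDiag_succ_eq_updateRow {m r : ℕ} (hr : r + 1 ≤ m + 1)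
    (A : Matrix (Fin (m + 1)) (Fin (m + 1)) (MvPolynomial σ K)) (i₀ : Fin (m + 1))
    (hi₀ : (i₀ : ℕ) = m - r) :
    A + (lambdaDiag K (m + 1) (r + 1)).map (C : K →+* MvPolynomial σ K) =
      (A + (lambdaDiag K (m + 1) r).map (C : K →+* MvPolynomial σ K)).updateRow i₀
        ((A + (lambdaDiag K (m + 1) r).map (C : K →+* MvPolynomial σ K)) i₀ + Pi.single i₀ 1) := by
  ext p q
  by_cases hp : p = i₀
  · subst hp
    rw [Matrix.updateRow_self, Pi.add_apply, Matrix.add_apply, Matrix.add_apply, Matrix.map_apply,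
      Matrix.map_apply, lambdaDiag_apply, lambdaDiag_apply]
    by_cases hq : p = q
    · subst hq
      rw [if_pos rfl, if_pos rfl, if_pos (by omega), if_neg (by omega), Pi.single_eq_same, map_one,
        map_zero, add_zero]
    · rw [if_neg hq, if_neg hq, Pi.single_eq_of_ne (Ne.symm hq), add_zero]
  · rw [Matrix.updateRow_ne hp, Matrix.add_apply, Matrix.add_apply, Matrix.map_apply, Matrix.map_apply,
      lambdaDiag_apply, lambdaDiag_apply]
    by_cases hq : p = q
    · subst hq
      rw [if_pos rfl, if_pos rfl]
      have hp' : (p : ℕ) ≠ m - r := fun h => hp (Fin.ext (by rw [h, hi₀]))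
      by_cases h1 : m + 1 - (r + 1) ≤ (p : ℕ)
      · rw [if_pos h1, if_pos (by omega)]
      · rw [if_neg h1, if_neg (by omega)]
    · rw [if_neg hq, if_neg hq]

/-- Deleting row and column `i₀ = m - r` from `A + Λ_{m+1}^r` gives `A' + Λ_m^r`.
[cite: Yabe2015, Lemma 5.3 (proof)] -/
private theorem submatrix_add_lambdaDiag {m r : ℕ} (hr : r ≤ m)
    (A : Matrix (Fin (m + 1)) (Fin (m + 1)) (MvPolynomial σ K)) (i₀ : Fin (m + 1))
    (hi₀ : (i₀ : ℕ) = m - r) :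
    (A + (lambdaDiag K (m + 1) r).map (C : K →+* MvPolynomial σ K)).submatrix i₀.succAbove i₀.succAbove =
      A.submatrix i₀.succAbove i₀.succAbove + (lambdaDiag K m r).map (C : K →+* MvPolynomial σ K) := by
  ext a b
  rw [Matrix.submatrix_apply, Matrix.add_apply, Matrix.add_apply, Matrix.submatrix_apply,
    Matrix.map_apply, Matrix.map_apply, lambdaDiag_apply, lambdaDiag_apply]
  by_cases hab : a = b
  · subst hab
    rw [if_pos rfl, if_pos rfl]
    have hv := val_succAbove i₀ a
    by_cases ha : (a : ℕ) < i₀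
    · rw [if_pos ha] at hv
      rw [if_neg (by omega), if_neg (by omega)]
    · rw [if_neg ha] at hv
      rw [if_pos (by omega), if_pos (by omega)]
  · rw [if_neg (fun h => hab (Fin.succAbove_right_injective h)), if_neg hab]

/-- **Yabe 2015, Lemma 5.3 (i), conditional on Prop. 5.2** (p0012): for `r ∈ [n - 2k, n - 1]`,
`brank(p_{A,2k,r}) ≤ 2^{n-r-1}(n + 2(k-1)D^{k-1})`, by induction on `n - r` from Prop. 5.2 via
`det(A + Λ_n^{r}) = det(A + Λ_n^{r+1}) - det(A' + Λ_{n-1}^{r})` and subadditivity of `brank`. Here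
stated with `z = n - r`. [cite: Yabe2015, Lemma 5.3] -/
theorem bRank_homogeneousComponent_det_add_lambdaDiag_le [Fintype σ] [DecidableEq σ]
    (h52 : yabe2015_prop_5_2.{u, v}) {k : ℕ} (hk : 1 ≤ k) :
    ∀ z : ℕ, 1 ≤ z → z ≤ 2 * k →
      ∀ (n r : ℕ) (A : Matrix (Fin n) (Fin n) (MvPolynomial σ K)),
        (∀ i j, (A i j).IsHomogeneous 1) → n = r + z →
        bRank k (homogeneousComponent (2 * k) (A + (lambdaDiag K n r).map (C : K →+* MvPolynomial σ K)).det) ≤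
          2 ^ (z - 1) * (n + 2 * (k - 1) * Fintype.card σ ^ (k - 1)) := by
  intro z hz
  induction z, hz using Nat.le_induction with
  | base =>
      intro _ n r A hA hn
      subst hn
      have h := h52 K σ (r + 1) k A hk hA
      rw [Nat.add_sub_cancel] at h
      simpa using h
  | succ z hz ih =>
      intro hzk n r A hA hn
      -- `n = m + 1` with `m = r + z`; `i₀ = z = m - r` is the last zero of `Λ_n^r`
      obtain ⟨m, rfl⟩ : ∃ m, n = m + 1 := ⟨r + z, by omega⟩
      have hm : m = r + z := by omega
      set i₀ : Fin (m + 1) := ⟨z, by omega⟩ with hi₀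
      have hi₀v : (i₀ : ℕ) = m - r := by rw [hi₀]; simp only; omega
      set M := A + (lambdaDiag K (m + 1) r).map (C : K →+* MvPolynomial σ K) with hM
      set A' : Matrix (Fin m) (Fin m) (MvPolynomial σ K) := A.submatrix i₀.succAbove i₀.succAbove with hA'
      have hA'1 : ∀ i j, (A' i j).IsHomogeneous 1 := fun i j => hA _ _
      -- `det M = det(A + Λ^{r+1}) - det(A' + Λ_m^r)`
      have hdet : M.det = (A + (lambdaDiag K (m + 1) (r + 1)).map (C : K →+* MvPolynomial σ K)).det -
          (A' + (lambdaDiag K m r).map (C : K →+* MvPolynomial σ K)).det := by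
        rw [add_lambdaDiag_succ_eq_updateRow (by omega) A i₀ hi₀v, ← hM, det_updateRow_add_single,
          hM, submatrix_add_lambdaDiag (by omega) A i₀ hi₀v, ← hA', add_sub_cancel_right]
      rw [hdet, map_sub]
      have ih₁ := ih (by omega) (m + 1) (r + 1) A hA (by omega)
      have ih₂ := ih (by omega) m r A' hA'1 (by omega)
      refine (bRank_sub_le' (homogeneousComponent_isHomogeneous _ _)
        (homogeneousComponent_isHomogeneous _ _)).trans ((Nat.add_le_add ih₁ ih₂).trans ?_)
      have hpow : 2 ^ (z + 1 - 1) = 2 * 2 ^ (z - 1) := by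
        rw [show z + 1 - 1 = (z - 1) + 1 by omega, pow_succ, mul_comm]
      rw [hpow]
      set X := 2 ^ (z - 1)
      set c := 2 * (k - 1) * Fintype.card σ ^ (k - 1)
      calc X * (m + 1 + c) + X * (m + c) = X * ((m + 1 + c) + (m + c)) := by ring
        _ ≤ X * (2 * (m + 1 + c)) := Nat.mul_le_mul_left _ (by omega)
        _ = 2 * X * (m + 1 + c) := by ring

/-- `k ≤ 2^{2k-2}` for `k ≥ 1`. [folklore] -/
private theorem le_two_pow_two_mul_sub_two {k : ℕ} (hk : 1 ≤ k) : k ≤ 2 ^ (2 * k - 2) := by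
  induction k, hk using Nat.le_induction with
  | base => simp
  | succ k hk ih =>
      rw [show 2 * (k + 1) - 2 = (2 * k - 2) + 2 by omega, pow_add]
      have : 1 ≤ 2 ^ (2 * k - 2) := Nat.one_le_two_pow
      omega

/-- **Yabe 2015, Theorem 1.5, reduced to Prop. 5.2 and Lemma 5.1** (proof of Thm. 1.5, p0012):
from `p_{x₀} = det(A + Λ_n^r)` (Lemma 5.1), `brank(p_{x₀}^{(2k)})` is `0` if `r < n - 2k`
(`homogeneousComponent_det_add_lambdaDiag_of_lt`), at most `2k · D^{k-1}` if `r = n - 2k`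
(`bRank_det_le_of_linear'`, replacing Lemma 5.3 (ii)), and at most `2^{n-r-1}(n + 2(k-1)D^{k-1})`
if `r ∈ [n-2k+1, n-1]` (Lemma 5.3 (i)); in every case `≤ 2^{2k-2}(n + 2(k-1)D^{k-1})`.
[cite: Yabe2015, Theorem 1.5 (proof)] -/
theorem yabe2015_thm_1_5_of (h52 : yabe2015_prop_5_2.{u, v}) (h51 : yabe2015_lemma_5_1.{u, v}) :
    yabe2015_thm_1_5.{u, v} := by
  intro K _ σ _ _ p k x₀ hk _ hx
  classical
  obtain ⟨n, hn⟩ : ∃ n, determinantalComplexity p = n := ⟨_, rfl⟩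
  obtain ⟨A, r, hA, hr, hdet⟩ := h51 K σ p n x₀ hn hx
  rw [hdet, hn]
  set c := 2 * (k - 1) * Fintype.card σ ^ (k - 1) with hc
  rcases Nat.lt_trichotomy (2 * k) (n - r) with hlt | heq | hgt
  · -- `r < n - 2k`: the degree-`2k` part vanishes
    rw [Yabe.homogeneousComponent_det_add_lambdaDiag_of_lt A hA hlt, bRank_zero']
    exact Nat.zero_le _
  · -- `r = n - 2k`: determinant of the leading `2k × 2k` block
    have hb := Yabe.homogeneousComponent_det_add_lambdaDiag_eq_det_block (r := r) A hA
    rw [show homogeneousComponent (2 * k) (A + (lambdaDiag K n r).map (C : K →+* MvPolynomial σ K)).det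
        = homogeneousComponent (n - r) (A + (lambdaDiag K n r).map (C : K →+* MvPolynomial σ K)).det
        from by rw [heq], hb]
    refine (Yabe.bRank_det_le_of_linear' hk (by rw [Fintype.card_fin]; omega) _
      (fun i j => hA _ _)).trans ?_
    -- `2k · D^{k-1} ≤ 2^{2k-2} (n + 2(k-1) D^{k-1})`, using `n ≥ 2k`
    rcases Nat.lt_or_ge k 2 with hk1 | hk2
    · obtain rfl : k = 1 := by omega
      norm_num at hc ⊢
      omega
    · have hP : k ≤ 2 ^ (2 * k - 2) := le_two_pow_two_mul_sub_two hk
      calc 2 * k * Fintype.card σ ^ (k - 1)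
          = k * 2 * Fintype.card σ ^ (k - 1) := by ring
        _ ≤ 2 ^ (2 * k - 2) * (2 * (k - 1)) * Fintype.card σ ^ (k - 1) :=
            Nat.mul_le_mul_right _ (Nat.mul_le_mul hP (by omega))
        _ = 2 ^ (2 * k - 2) * c := by rw [hc]; ring
        _ ≤ 2 ^ (2 * k - 2) * (n + c) := Nat.mul_le_mul_left _ (by omega)
  · -- `r ∈ [n - 2k + 1, n - 1]`: Lemma 5.3 (i)
    have hz1 : 1 ≤ n - r := by omega
    have hz2 : n - r ≤ 2 * k := by omega
    have hnr : n = r + (n - r) := by omega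
    have h := bRank_homogeneousComponent_det_add_lambdaDiag_le h52 hk (n - r) hz1 hz2 n r A hA hnr
    have hexp : n - r - 1 ≤ 2 * k - 2 := by omega
    exact h.trans (Nat.mul_le_mul_right _ (Nat.pow_le_pow_right (by norm_num) hexp))

end Yabe

end Literature.Computability.AlgebraicComplexity

end
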